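import Summits.FinalStateConjecture.FinalStateConjecture.Theses.StarvedNecks
import Summits.FinalStateConjecture.FinalStateConjecture.Theorems.StarvedNecksNeckGapDecayOfAnalytic
import HarnessLib.Audit

/-!
# Line `Sketch` (idea `connection-level-cones`) — crux `StarvedNecks.NeckGapDecay` (stmt-FinalStateConjecture-16768)

Lead's skeleton **v11** (continuation lead prover-line-stmt-FinalStateConjecture-16768-c4-0, 2026-08-17; v9–v10 by c3,
v7–v8 by c1, v1–v6 by prover-line-stmt-FinalStateConjecture-16768-0, owned unchanged by c2).

v11 RESHAPE (c4): the ONE open stub is now the HYPOTHESIS-FREE ANALYTIC form of the physics,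
`stub_gapAnalyticAll : OfCore.GapAnalyticAll` (tree constant, `Theorems/StarvedNecksNeckGapDecayOfAnalytic.lean`):
for every admissible datum, MGHD, honest `C⁴` decomposition and EVERY hole `i`, a threshold `T₀`, a normalised
dominating wall `W` and a gap ANALYTIC certificate `GapAnalyticCert` — ONE smooth open embedding of the late sub-wall
tube into `d.charted`, `= Ψᵢ` inside `R₁ + 1`, `C²`-converging to boosted Kerrᵢ on the sub-wall slabs out to
`W ≥ 3ρᵢ + 2`.  It is the WEAKEST sufficient statement in the tree: `OfCore.gapAnalyticAll_of_gapCoreHolds :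
GapCoreHolds → GapAnalyticAll` (v10's stub implies it, via `cert_of_selfCertified` and the landed P-glue) and
`OfCore.neckGapDecay_of_gapAnalyticAll : GapAnalyticAll → <body of Theses.StarvedNecks.NeckGapDecay, verbatim>`
(the composition below, BY NAME).  It is literally the crux's informal text (gap annulus `C²`-certified by a chart of
the late tube equal to `Ψᵢ` near the hole) minus its soft consequences (G4)/(G5), all theorems of the tree.  Anchors
landed by c4: `selfCertified_of_excision_le` / `gapCoreClause_of_excision_le` (p172545: bounded excision ⇒
self-certified — the open content concerns only holes with unbounded `ρᵢ`), `gapCoreCert_of_selfCertified` /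
`forall_gapCoreCert_of_gapCoreHolds` (p172723: the `¬ selfCertified` hypothesis of v10's stub is cosmetic).
The history of the line (v1–v10) is `Lines/Sketch.md` and the git history of this file.

STATUS of the stub: OPEN PROBLEM — rate-free `C²` late-time decay of the vacuum metric on the intermediate zone
`{R₁ + 1 < rᵢ ≤ W(x⁰)}` between the fixed-radius-certified near zone and the flat-certified radiation zone, from `C⁰`
a-priori control + the two certificates + data provenance; unprinted even for `N = 1`, `a = 0`; no local
`C⁰ + vacuum ⇒ C²` upgrade exists (Burnett high-frequency vacuum waves, Luk–Rodnianski arXiv:2009.08968, Touati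
arXiv:2404.07659), so the statement is irreducibly the global late-time starvation of the neck (planner dossier
`Cruxes/NeckGapDecay/PROMOTE-GapCore.md`).
-/

noncomputable section

namespace Summit.FinalStateConjecture.FinalStateConjecture.Cruxes.NeckGapDecay.ConnectionLevelCones

open Summit.FinalStateConjecture.FinalStateConjecture.Theorems.NeckGapDecay.ConnectionLevelCones.OfCore
  (GapAnalyticAll GapCoreHolds neckGapDecay_of_gapAnalyticAll gapAnalyticAll_of_gapCoreHolds)

set_option linter.dupNamespace false

/-- Registered stub P-an (physics, XL; lead) — the ONE open stub of the line: the hypothesis-free analytic form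
`OfCore.GapAnalyticAll` of the crux's physics (tree constant, `Theorems/StarvedNecksNeckGapDecayOfAnalytic.lean`). -/
theorem stub_gapAnalyticAll : GapAnalyticAll := by
  sorry

/-! ## Registered signatures, name-keyed -/

namespace Registered

/-- P-an (open; lead; hypothesis-free since v11). -/ abbrev stub_gapAnalyticAll : Prop := GapAnalyticAll

end Registered

/-- **Skeleton theorem (v11).**  P-an implies the crux `StarvedNecks.NeckGapDecay` BY NAME — by the tree's
reduction `OfCore.neckGapDecay_of_gapAnalyticAll` (whose conclusion is the crux decl's body verbatim). -/
theorem NeckGapDecay_of (hall : Registered.stub_gapAnalyticAll) :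
    Summit.FinalStateConjecture.FinalStateConjecture.Theses.StarvedNecks.NeckGapDecay :=
  neckGapDecay_of_gapAnalyticAll hall

/-- Wiring check: the registered stub feeds `NeckGapDecay_of` as stated. -/
example : Summit.FinalStateConjecture.FinalStateConjecture.Theses.StarvedNecks.NeckGapDecay :=
  NeckGapDecay_of stub_gapAnalyticAll

/-- Backward compatibility with v10: the former stub `OfCore.GapCoreHolds` still closes the crux (it implies P-an). -/
example (gapCore_proof : GapCoreHolds) :
    Summit.FinalStateConjecture.FinalStateConjecture.Theses.StarvedNecks.NeckGapDecay :=
  NeckGapDecay_of (gapAnalyticAll_of_gapCoreHolds gapCore_proof)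

/-- The eventual CLOSING FILE (`Theorems/StarvedNecksNeckGapDecay.lean --workitem stmt-FinalStateConjecture-16768`) is,
verbatim, `theorem NeckGapDecay_proof : <body of NeckGapDecay> := OfCore.neckGapDecay_of_gapAnalyticAll gapAnalyticAll_proof`
once `gapAnalyticAll_proof : OfCore.GapAnalyticAll` exists (Theses-free: the gate re-renders the route file importing it). -/
example (gapAnalyticAll_proof : GapAnalyticAll) :
    Summit.FinalStateConjecture.FinalStateConjecture.Theses.StarvedNecks.NeckGapDecay :=
  neckGapDecay_of_gapAnalyticAll gapAnalyticAll_proof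

end Summit.FinalStateConjecture.FinalStateConjecture.Cruxes.NeckGapDecay.ConnectionLevelCones

end
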